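import Literature.Analysis.FluidPDE.KochTataruFixedPoint
import Literature.Analysis.FunctionSpaces.BMOCarlesonPotential
import HarnessLib

/-!
# Koch–Tataru's Theorem 2: the free evolution of `BMO⁻¹` data lies in `X` ((L2) discharged)

Analysis/FluidPDE proof companion of `Literature/Analysis/FluidPDE/KochTataru.lean` (the
decomposition of the named fact `Literature.Analysis.FluidPDE.koch_tataru`, **ns.S15**, Koch–Tataru 2001, Theorem 2)
and `Literature/Analysis/FluidPDE/KochTataruFixedPoint.lean` (the fixed point (T1), (T2) from
(L1), (L2)). This file **discharges the named fact (L2)** `NS.eKochTataruNorm_heatExtension_le`: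

> there is `C = C(E)` such that for every polynomially tempered `u₀ ∈ BMO⁻¹(E; E)` the caloric
> extension `(t, x) ↦ e^{tΔ}u₀ (x)` is measurable on `(0, ∞) × E` and
> `‖e^{·Δ}u₀‖_X ≤ C ‖u₀‖_{BMO⁻¹}`

(`NS.eKochTataruNorm_heatExtension_le_holds`), from the discharged Koch–Tataru Theorem 1 cluster
of `Literature/Analysis/FunctionSpaces/BMOCarleson*.lean`, and records the resulting reduction
`NS.koch_tataru_of_L1_T3_T4 : (L1) → (T3) → (T4) → koch_tataru`.

## The proof (Koch–Tataru 2001, §1 (2)–(3), (22) and Theorem 1; Lemarié-Rieusset 2016, p. 219)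

Koch–Tataru *define* `‖u₀‖_{BMO⁻¹}` as the Carleson part of `‖S(·)u₀‖_X` ((2)–(3)); the `L^∞`
part of `‖S(·)u₀‖_X` is their pointwise bound (22), `|e^{tΔ}u₀| ≤ C t^{-1/2}‖u₀‖_{BMO⁻¹}`, and
Theorem 1 compares the Carleson norm with the divergence-form norm of this tree
(`Literature.eBMOInvNorm = inf {sup_{‖v‖≤1} ‖⟪Φ, v⟫‖_* : u₀ = div Φ}`). Accordingly:

* `§ Components`: the vector caloric extension `Literature.heatExtension u₀ t` (convolution form, trunk
  `UnboundedOperators`) has components `⟪e^{tΔ}u₀, v⟫ = e^{tΔ}⟪u₀, v⟫` given by the scalar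
  extension `Literature.Analysis.FunctionSpaces.BMOInv.heatExtension` of `BMO.lean` (`inner_heatExtension_eq_heatExtension_inner`:
  change of variables and the inner product through the Bochner integral, for polynomially
  tempered `u₀`); joint measurability follows componentwise (`aestronglyMeasurable_heatExtension`).
* `§ ScalarCarleson`: for a tempered scalar `w = div Φ`,
  `γ(w) := sup_{x,R} R^{-d}∫₀^{R²}∫_{B(x,R)}|e^{tΔ}w|² ≤ K (sup_{‖v‖≤1}‖⟪Φ,v⟫‖_*)²`
  (`exists_eCarlesonNorm_le_mul_eBMOSeminormVec_sq`: the cluster's `eCarlesonNorm_le_of_divergence`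
  with the discharged facts (C) and (A), and Fefferman–Stein (B) from the discharged John–Nirenberg
  inequality), hence `γ(w) ≤ K ‖w‖²_{BMO⁻¹}` by taking the infimum over `Φ`
  (`exists_eCarlesonNorm_le_mul_eBMOInvNorm_sq`).
* `§ Linear`: with `ρ = ‖u₀‖_{BMO⁻¹}` and an orthonormal frame `(bᵢ)`, the components
  `wᵢ = ⟪u₀, bᵢ⟫` have `γᵢ ≤ K ρ²`; Koch–Tataru's (22) in the form of the cluster
  (`BMOInv.exists_sq_heatExtension_le`: `|e^{tΔ}wᵢ|² ≤ C₀ γᵢ / t`) gives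
  `√t ‖e^{tΔ}u₀‖_∞ ≤ √(d C₀ K) ρ`, and summing the `d` component boxes gives the Carleson part
  `≤ √(d K) ρ`; so `C = √(d C₀ K) + √(d K) + 1` works.

## References

* H. Koch, D. Tataru, *Well-posedness for the Navier–Stokes equations*, Adv. Math. 157 (2001)
  22–35, §1 (2)–(3), Theorem 1, §4 (22). Bib key `KochTataruAdvMath2001`.
* P. G. Lemarié-Rieusset, *The Navier–Stokes problem in the 21st century*, CRC Press 2016, §9.1,
  p. 219 (`‖W_{νt} ∗ u₀‖_{E_∞} ≈ ‖u₀‖_{BMO⁻¹}`). Bib key `LemarieRieusset2016`.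
-/

noncomputable section

open MeasureTheory Set Function Filter Topology Metric
open scoped ENNReal NNReal RealInnerProductSpace

namespace Literature.Analysis.FluidPDE

variable {E : Type*} [NormedAddCommGroup E] [InnerProductSpace ℝ E] [FiniteDimensional ℝ E]
  [MeasurableSpace E] [BorelSpace E]

/-! ## Components of the vector caloric extension -/

section Components

/-- A polynomially tempered field is a.e.-strongly measurable. [folklore] -/
theorem IsPolynomiallyTempered.aestronglyMeasurable {u₀ : E → E} (h : IsPolynomiallyTempered u₀) :
    AEStronglyMeasurable u₀ volume := by
  obtain ⟨N, hN⟩ := h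
  have h1 : AEStronglyMeasurable
      (fun y => ((1 + ‖y‖ ^ 2) ^ N : ℝ) • (((1 + ‖y‖ ^ 2) ^ N : ℝ)⁻¹ • u₀ y)) volume :=
    (Continuous.aestronglyMeasurable (by fun_prop)).smul hN.1
  refine h1.congr (Eventually.of_forall fun y => ?_)
  have : ((1 + ‖y‖ ^ 2) ^ N : ℝ) ≠ 0 := by positivity
  simp only [smul_smul, mul_inv_cancel₀ this, one_smul]

/-- The norm of a polynomially tempered field has Stein/Koch–Tataru growth
`(1 + ‖y‖)^{-2N} ‖u₀‖ ∈ L¹`. [folklore] -/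
theorem IsPolynomiallyTempered.integrable_growth_norm {u₀ : E → E} (h : IsPolynomiallyTempered u₀) :
    ∃ K : ℕ, Integrable fun y => ((1 + ‖y‖) ^ K)⁻¹ * ‖u₀ y‖ := by
  obtain ⟨N, hN⟩ := h
  refine ⟨2 * N, FunctionSpaces.BMOInv.integrable_growth_of_tempered ?_⟩
  have := hN.norm
  refine this.congr (Eventually.of_forall fun y => ?_)
  simp only [norm_smul, norm_inv, norm_pow]
  rw [Real.norm_of_nonneg (by positivity)]

/-- Components of a polynomially tempered field are tempered in Koch–Tataru's sense
`(1 + ‖y‖²)^{-N} ⟪u₀, v⟫ ∈ L¹`. [folklore] -/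
theorem IsPolynomiallyTempered.inner_const {u₀ : E → E} (h : IsPolynomiallyTempered u₀) (v : E) :
    ∃ N : ℕ, Integrable fun y => ((1 + ‖y‖ ^ 2) ^ N : ℝ)⁻¹ * ⟪u₀ y, v⟫ := by
  obtain ⟨N, hN⟩ := h
  refine ⟨N, (hN.inner_const v).congr (Eventually.of_forall fun y => ?_)⟩
  simp only [real_inner_smul_left]

/-- Components of a polynomially tempered field have Stein growth `(1 + ‖y‖)^{-K} ⟪u₀, v⟫ ∈ L¹`.
[folklore] -/
theorem IsPolynomiallyTempered.integrable_growth_inner {u₀ : E → E} (h : IsPolynomiallyTempered u₀)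
    (v : E) : ∃ K : ℕ, Integrable fun y => ((1 + ‖y‖) ^ K)⁻¹ * ⟪u₀ y, v⟫ := by
  obtain ⟨N, hN⟩ := h.inner_const v
  exact ⟨2 * N, FunctionSpaces.BMOInv.integrable_growth_of_tempered hN⟩

/-- The integrand of the vector caloric extension of a tempered field is integrable:
`K_t(y - ·) • u₀ ∈ L¹` for `t > 0`. [folklore] -/
theorem IsPolynomiallyTempered.integrable_heatKernel_smul {u₀ : E → E}
    (h : IsPolynomiallyTempered u₀) {t : ℝ} (ht : 0 < t) (y : E) :
    Integrable fun z => Literature.Analysis.UnboundedOperators.heatKernel t (y - z) • u₀ z := by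
  obtain ⟨K, hK⟩ := h.integrable_growth_norm
  have hint : Integrable fun z => FunctionSpaces.BMOInv.heatKernel t (y - z) * ‖u₀ z‖ :=
    FunctionSpaces.BMOInv.integrable_heatKernel_mul_of_growth hK ht y
  have hmeas : AEStronglyMeasurable (fun z => Literature.Analysis.UnboundedOperators.heatKernel t (y - z) • u₀ z) volume :=
    ((UnboundedOperators.continuous_heatKernel t).comp (continuous_const.sub continuous_id)).aestronglyMeasurable.smul
      h.aestronglyMeasurable
  refine hint.mono' hmeas (Eventually.of_forall fun z => ?_)
  rw [norm_smul, Real.norm_of_nonneg (UnboundedOperators.heatKernel_pos ht _).le]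
  rfl

/-- **Components of the vector caloric extension**: for a polynomially tempered field `u₀` and
`t > 0`, `⟪e^{tΔ}u₀ (y), v⟫ = e^{tΔ}⟪u₀, v⟫ (y)` with the vector extension `Literature.Analysis.UnboundedOperators.heatExtension`
(convolution `∫ K_t(z) u₀(y - z) dz`) on the left and the scalar extension `BMOInv.heatExtension`
(`∫ K_t(y - z) ⟪u₀(z), v⟫ dz`) of `BMO.lean` on the right (change of variables `z ↦ y - z` and
the inner product through the Bochner integral; Koch–Tataru 2001, (2)). [cite: KochTataruAdvMath2001, (2)] -/
theorem inner_heatExtension_eq_heatExtension_inner {u₀ : E → E} (h : IsPolynomiallyTempered u₀)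
    {t : ℝ} (ht : 0 < t) (y v : E) :
    ⟪Literature.Analysis.UnboundedOperators.heatExtension u₀ t y, v⟫ = FunctionSpaces.BMOInv.heatExtension (fun z => ⟪u₀ z, v⟫) t y := by
  rw [UnboundedOperators.heatExtension_apply]
  have hcv : ∫ z, Literature.Analysis.UnboundedOperators.heatKernel t z • u₀ (y - z) = ∫ z, Literature.Analysis.UnboundedOperators.heatKernel t (y - z) • u₀ z := by
    rw [← integral_sub_left_eq_self (fun z => Literature.Analysis.UnboundedOperators.heatKernel t (y - z) • u₀ z) volume y]
    refine integral_congr_ae (Eventually.of_forall fun z => ?_)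
    simp only [sub_sub_cancel]
  rw [hcv, real_inner_comm, ← integral_inner (h.integrable_heatKernel_smul ht y) v]
  unfold FunctionSpaces.BMOInv.heatExtension
  refine integral_congr_ae (Eventually.of_forall fun z => ?_)
  simp only [real_inner_smul_right]
  rw [real_inner_comm]
  rfl

/-- The vector caloric extension in an orthonormal frame:
`e^{tΔ}u₀ (y) = Σᵢ e^{tΔ}⟪u₀, bᵢ⟫ (y) bᵢ` for tempered `u₀` and `t > 0`. [folklore] -/
theorem heatExtension_eq_sum_heatExtension_inner {u₀ : E → E} (h : IsPolynomiallyTempered u₀)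
    (b : OrthonormalBasis (Fin (Module.finrank ℝ E)) ℝ E) {t : ℝ} (ht : 0 < t) (y : E) :
    Literature.Analysis.UnboundedOperators.heatExtension u₀ t y = ∑ i, FunctionSpaces.BMOInv.heatExtension (fun z => ⟪u₀ z, b i⟫) t y • b i := by
  conv_lhs => rw [← b.sum_repr' (Literature.Analysis.UnboundedOperators.heatExtension u₀ t y)]
  refine Finset.sum_congr rfl fun i _ => ?_
  rw [real_inner_comm, inner_heatExtension_eq_heatExtension_inner h ht]

/-- **Measurability of the free evolution**: `(t, y) ↦ e^{tΔ}u₀ (y)` is a.e.-strongly measurable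
on `(0, ∞) × E` for polynomially tempered `u₀` (componentwise, from the joint measurability of
the scalar caloric extension). [folklore] -/
theorem aestronglyMeasurable_heatExtension {u₀ : E → E} (h : IsPolynomiallyTempered u₀) :
    AEStronglyMeasurable (uncurry fun t => Literature.Analysis.UnboundedOperators.heatExtension u₀ t)
      ((volume : Measure (ℝ × E)).restrict (Ioi 0 ×ˢ univ)) := by
  obtain ⟨b⟩ : Nonempty (OrthonormalBasis (Fin (Module.finrank ℝ E)) ℝ E) :=
    ⟨stdOrthonormalBasis ℝ E⟩
  have hcomp : ∀ i, Measurable fun p : ℝ × E =>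
      FunctionSpaces.BMOInv.heatExtension (fun z => ⟪u₀ z, b i⟫) p.1 p.2 := fun i =>
    FunctionSpaces.BMOInv.measurable_heatExtension
      (h.aestronglyMeasurable.inner_const : AEStronglyMeasurable (fun z => ⟪u₀ z, b i⟫) volume)
  have hsum : Measurable fun p : ℝ × E =>
      ∑ i, FunctionSpaces.BMOInv.heatExtension (fun z => ⟪u₀ z, b i⟫) p.1 p.2 • b i :=
    Finset.measurable_sum _ fun i _ => (hcomp i).smul_const (b i)
  refine (hsum.aestronglyMeasurable).congr ?_
  filter_upwards [ae_restrict_mem (measurableSet_Ioi.prod MeasurableSet.univ)] with p hp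
  exact (heatExtension_eq_sum_heatExtension_inner h b hp.1 p.2).symm

end Components

/-! ## The Carleson quantity of a divergence: `γ(div Φ) ≤ C ‖Φ‖²_*` and the infimum over `Φ` -/

section ScalarCarleson

/-- **The Carleson quantity of a weak divergence is controlled by the `BMO` seminorm of the
representing field**: there is `C = C(E)` such that for every tempered `w = div Φ` (weakly),
`sup_{x,R} R^{-d}∫₀^{R²}∫_{B(x,R)} |e^{tΔ}w|² ≤ C (sup_{‖v‖≤1} ‖⟪Φ, v⟫‖_*)²` (Koch–Tataru 2001,
§4, proof of Theorem 1, first display: `‖∇·f‖²_{BMO⁻¹} ≤ Σ‖fⁱ‖²_{BMO}`, i.e. the easy direction of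
Theorem 1 through Fefferman–Stein `BMO ⇒ Carleson`; here from the discharged cluster facts
`eCarlesonNorm_le_of_divergence`, (C), (A) and (B) from John–Nirenberg). If some component of `Φ`
is not in `BMO` the right-hand side is `∞`. [cite: KochTataruAdvMath2001, §4 proof of Theorem 1 (first display)] -/
theorem exists_eCarlesonNorm_le_mul_eBMOSeminormVec_sq :
    ∃ C : ℝ≥0, 0 < C ∧ ∀ {w : E → ℝ} {Φ : E → E}, FunctionSpaces.HasWeakDivergenceRepresentation w Φ →
      (∃ N : ℕ, Integrable fun y => ((1 + ‖y‖ ^ 2) ^ N)⁻¹ * w y) →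
      FunctionSpaces.BMOInv.eCarlesonNorm w ≤ C * FunctionSpaces.eBMOSeminormVec Φ ^ 2 := by
  obtain ⟨CB, hCB⟩ := FunctionSpaces.BMOInv.eCarlesonGradNorm_le_of_memBMO_of_john_nirenberg (E := E)
    FunctionSpaces.john_nirenberg_holds
  -- the constant `d² (C_B + 1) + 1`
  refine ⟨(Module.finrank ℝ E * Module.finrank ℝ E : ℕ) * (CB + 1) + 1,
    add_pos_of_nonneg_of_pos bot_le zero_lt_one, fun {w Φ} hrep htemp => ?_⟩
  have hcoe : (((Module.finrank ℝ E * Module.finrank ℝ E : ℕ) * (CB + 1) + 1 : ℝ≥0) : ℝ≥0∞) =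
      (Module.finrank ℝ E * Module.finrank ℝ E : ℕ) * ((CB : ℝ≥0∞) + 1) + 1 := by
    push_cast
    ring
  rw [hcoe]
  obtain ⟨b⟩ : Nonempty (OrthonormalBasis (Fin (Module.finrank ℝ E)) ℝ E) :=
    ⟨stdOrthonormalBasis ℝ E⟩
  have hcomp_le : ∀ i, FunctionSpaces.eBMOSeminorm (fun x => ⟪Φ x, b i⟫) ≤ FunctionSpaces.eBMOSeminormVec Φ := fun i =>
    le_iSup₂_of_le (b i) (by rw [b.orthonormal.1 i]) le_rfl
  by_cases hall : ∀ i, FunctionSpaces.MemBMO (fun x => ⟪Φ x, b i⟫)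
  · -- all coordinate components are `BMO`: run `eCarlesonNorm_le_of_divergence`
    have hgrowth : ∀ v : E,
        Integrable fun y => ((1 + ‖y‖) ^ (Module.finrank ℝ E + 1))⁻¹ * ⟪Φ y, v⟫ := by
      intro v
      have hrepr : (fun y => ((1 + ‖y‖) ^ (Module.finrank ℝ E + 1))⁻¹ * ⟪Φ y, v⟫) =
          fun y => ∑ i, ⟪b i, v⟫ * (((1 + ‖y‖) ^ (Module.finrank ℝ E + 1))⁻¹ * ⟪Φ y, b i⟫) := by
        funext y
        conv_lhs => rw [← b.sum_repr' v]
        simp only [inner_sum, real_inner_smul_right, Finset.mul_sum]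
        refine Finset.sum_congr rfl fun i _ => ?_
        ring
      rw [hrepr]
      exact integrable_finsetSum _ fun i _ =>
        (FunctionSpaces.MemBMO.integrable_inv_one_add_norm_pow_mul_holds (hall i)).const_mul _
    have hdiv := FunctionSpaces.eCarlesonNorm_le_of_divergence FunctionSpaces.heatExtension_eq_sum_inner_heatExtensionGrad_holds
      hrep htemp hgrowth b
    -- (no `calc` here: it triggers expensive definitional unfolding of the seminorms)
    have hsum : ∑ i, FunctionSpaces.BMOInv.eCarlesonGradNorm (fun z => ⟪Φ z, b i⟫) ≤
        ∑ _i : Fin (Module.finrank ℝ E), ((CB : ℝ≥0∞) + 1) * FunctionSpaces.eBMOSeminormVec Φ ^ 2 :=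
      Finset.sum_le_sum fun i _ =>
        (hCB (hall i)).trans (mul_le_mul' le_self_add (pow_le_pow_left' (hcomp_le i) 2))
    rw [Finset.sum_const, Finset.card_univ, Fintype.card_fin, nsmul_eq_mul] at hsum
    refine hdiv.trans ((mul_le_mul_of_nonneg_left hsum bot_le).trans ?_)
    have heq : (Module.finrank ℝ E : ℝ≥0∞) *
        (Module.finrank ℝ E * (((CB : ℝ≥0∞) + 1) * FunctionSpaces.eBMOSeminormVec Φ ^ 2)) =
        ((Module.finrank ℝ E * Module.finrank ℝ E : ℕ) : ℝ≥0∞) * ((CB : ℝ≥0∞) + 1) *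
          FunctionSpaces.eBMOSeminormVec Φ ^ 2 := by
      push_cast; ring
    rw [heq]
    exact mul_le_mul_of_nonneg_right le_self_add bot_le
  · -- some component is not `BMO`: then `‖Φ‖_* = ∞` and the bound is trivial
    push Not at hall
    obtain ⟨i, hi⟩ := hall
    have hli : LocallyIntegrable (fun x => ⟪Φ x, b i⟫) :=
      FunctionSpaces.locallyIntegrable_inner_const hrep.locallyIntegrable_field (b i)
    have htop : FunctionSpaces.eBMOSeminorm (fun x => ⟪Φ x, b i⟫) = ∞ := by
      by_contra hne
      exact hi ⟨hli, lt_top_iff_ne_top.2 hne⟩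
    have hstop : FunctionSpaces.eBMOSeminormVec Φ = ∞ := eq_top_iff.2 (htop ▸ hcomp_le i)
    rw [hstop, ENNReal.top_pow two_ne_zero, ENNReal.mul_top (by simp)]
    exact le_top

/-- **The Carleson quantity is controlled by the `BMO⁻¹` norm**: with the same `C`,
`γ(w) ≤ C ‖w‖²_{BMO⁻¹}` for every tempered `w` (infimum over the representations `w = div Φ` of
the previous bound; Koch–Tataru 2001, §1, (2)–(3) with Theorem 1: the Carleson quantity *is* the
square of Koch–Tataru's `BMO⁻¹` norm, and Theorem 1 compares it with the divergence-form norm).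
[cite: KochTataruAdvMath2001, §1 (2)–(3) and Theorem 1] -/
theorem exists_eCarlesonNorm_le_mul_eBMOInvNorm_sq :
    ∃ C : ℝ≥0, 0 < C ∧ ∀ {w : E → ℝ},
      (∃ N : ℕ, Integrable fun y => ((1 + ‖y‖ ^ 2) ^ N)⁻¹ * w y) →
      FunctionSpaces.BMOInv.eCarlesonNorm w ≤ C * FunctionSpaces.eBMOInvNorm w ^ 2 := by
  obtain ⟨C, hC0, hC⟩ := exists_eCarlesonNorm_le_mul_eBMOSeminormVec_sq (E := E)
  refine ⟨C, hC0, fun {w} htemp => ?_⟩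
  set a := FunctionSpaces.eBMOInvNorm w with ha
  -- for every `b > a` there is a representation with seminorm `< b`
  have hlt : ∀ b, a < b → FunctionSpaces.BMOInv.eCarlesonNorm w ≤ C * b ^ 2 := by
    intro b hb
    obtain ⟨Φ, hΦ⟩ := iInf_lt_iff.1 hb
    obtain ⟨hrep, hfin⟩ := iInf_lt_iff.1 hΦ
    exact (hC hrep htemp).trans (by gcongr)
  rcases eq_or_lt_of_le (le_top : a ≤ ∞) with htop | hfin
  · rw [htop, ENNReal.top_pow two_ne_zero, ENNReal.mul_top (by exact_mod_cast hC0.ne')]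
    exact le_top
  · -- `b = a + 1/(n+1) ↓ a`
    have hseq : Tendsto (fun n : ℕ => (C : ℝ≥0∞) * (a + (n : ℝ≥0∞)⁻¹) ^ 2) atTop
        (𝓝 ((C : ℝ≥0∞) * a ^ 2)) := by
      have h1 : Tendsto (fun n : ℕ => a + (n : ℝ≥0∞)⁻¹) atTop (𝓝 a) := by
        simpa using tendsto_const_nhds.add ENNReal.tendsto_inv_nat_nhds_zero
      have h2 : Tendsto (fun n : ℕ => (a + (n : ℝ≥0∞)⁻¹) ^ 2) atTop (𝓝 (a ^ 2)) :=
        ((ENNReal.continuous_pow 2).tendsto a).comp h1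
      exact ENNReal.Tendsto.const_mul h2 (Or.inr ENNReal.coe_ne_top)
    refine ge_of_tendsto hseq (Eventually.of_forall fun n => hlt _ ?_)
    exact ENNReal.lt_add_right hfin.ne (by simp)

end ScalarCarleson

/-! ## (L2): the free evolution of `BMO⁻¹` data lies in `X` -/

section Linear

/-- `‖e^{tΔ}u₀ (y)‖² = Σᵢ |e^{tΔ}⟪u₀, bᵢ⟫ (y)|²` in an orthonormal frame. [folklore] -/
theorem norm_heatExtension_sq_eq_sum {u₀ : E → E} (h : IsPolynomiallyTempered u₀)
    (b : OrthonormalBasis (Fin (Module.finrank ℝ E)) ℝ E) {t : ℝ} (ht : 0 < t) (y : E) :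
    ‖Literature.Analysis.UnboundedOperators.heatExtension u₀ t y‖ ^ 2 = ∑ i, FunctionSpaces.BMOInv.heatExtension (fun z => ⟪u₀ z, b i⟫) t y ^ 2 := by
  rw [← b.sum_sq_inner_left (Literature.Analysis.UnboundedOperators.heatExtension u₀ t y)]
  refine Finset.sum_congr rfl fun i _ => ?_
  rw [inner_heatExtension_eq_heatExtension_inner h ht]

variable (E) in
/-- **(L2) discharged: the free evolution of `BMO⁻¹` data lies in `X`**
(`NS.eKochTataruNorm_heatExtension_le`; Koch–Tataru 2001, §1 (2)–(3): the Carleson part of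
`‖S(·)u₀‖_X` is the `BMO⁻¹` norm; (22): `|S(t)u₀| ≤ c t^{-1/2}‖u₀‖_{BMO⁻¹}`; Theorem 1 for the
comparison with the divergence-form norm; Lemarié-Rieusset 2016, p. 219). Proof: in an orthonormal
frame the components of `e^{tΔ}u₀` are the scalar caloric extensions of the components
`wᵢ = ⟪u₀, bᵢ⟫` (`inner_heatExtension_eq_heatExtension_inner`), whose Carleson quantities satisfy
`γᵢ ≤ K ‖wᵢ‖²_{BMO⁻¹} ≤ K ρ²`, `ρ = ‖u₀‖_{BMO⁻¹}` (`exists_eCarlesonNorm_le_mul_eBMOInvNorm_sq`);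
the `L^∞` part follows from Koch–Tataru's (22) (`BMOInv.exists_sq_heatExtension_le`:
`|e^{tΔ}wᵢ|² ≤ C₀γᵢ/t`), the Carleson part by summing the `d` component boxes. The measurability
clause is `aestronglyMeasurable_heatExtension`. [cite: KochTataruAdvMath2001, §1 (2)–(3), (22) and Theorem 1] -/
theorem eKochTataruNorm_heatExtension_le_holds : eKochTataruNorm_heatExtension_le E := by
  obtain ⟨K, hK0, hK⟩ := exists_eCarlesonNorm_le_mul_eBMOInvNorm_sq (E := E)
  obtain ⟨C₀, hC₀, hsq⟩ := FunctionSpaces.BMOInv.exists_sq_heatExtension_le (E := E)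
  -- the constant (the `+ 1` only keeps it positive in dimension `0`)
  set A : ℝ := Real.sqrt (Module.finrank ℝ E * C₀ * K) + Real.sqrt (Module.finrank ℝ E * K) + 1 with hA
  have hApos : 0 < A := by positivity
  refine ⟨A.toNNReal, fun u₀ hmem htemp => ⟨aestronglyMeasurable_heatExtension htemp, ?_⟩⟩
  set ρ := eBMOInvNormVec u₀ with hρ
  obtain ⟨b⟩ : Nonempty (OrthonormalBasis (Fin (Module.finrank ℝ E)) ℝ E) :=
    ⟨stdOrthonormalBasis ℝ E⟩
  have hcoeA : ((A.toNNReal : ℝ≥0) : ℝ≥0∞) = ENNReal.ofReal A := rfl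
  rw [hcoeA]
  -- trivial if `ρ = ∞`
  rcases eq_or_lt_of_le (le_top : ρ ≤ ∞) with htop | hρfin
  · rw [htop, ENNReal.mul_top (by simpa [ENNReal.ofReal_eq_zero, not_le] using hApos)]
    exact le_top
  -- now `ρ < ∞`; component Carleson quantities
  have hγ : ∀ i, FunctionSpaces.BMOInv.eCarlesonNorm (fun z => ⟪u₀ z, b i⟫) ≤ K * ρ ^ 2 := by
    intro i
    calc FunctionSpaces.BMOInv.eCarlesonNorm (fun z => ⟪u₀ z, b i⟫)
        ≤ K * FunctionSpaces.eBMOInvNorm (fun z => ⟪u₀ z, b i⟫) ^ 2 := hK (htemp.inner_const (b i))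
      _ ≤ K * ρ ^ 2 := by
          gcongr
          exact eBMOInvNorm_inner_le_eBMOInvNormVec u₀ (by rw [b.orthonormal.1 i])
  have hγfin : ∀ i, FunctionSpaces.BMOInv.eCarlesonNorm (fun z => ⟪u₀ z, b i⟫) < ∞ := fun i =>
    (hγ i).trans_lt (ENNReal.mul_lt_top ENNReal.coe_lt_top (ENNReal.pow_lt_top hρfin))
  have hγreal : ∀ i, (FunctionSpaces.BMOInv.eCarlesonNorm (fun z => ⟪u₀ z, b i⟫)).toReal ≤ K * ρ.toReal ^ 2 := by
    intro i
    have := ENNReal.toReal_mono (ENNReal.mul_ne_top ENNReal.coe_ne_top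
      (ENNReal.pow_ne_top hρfin.ne)) (hγ i)
    rwa [ENNReal.toReal_mul, ENNReal.toReal_pow, ENNReal.coe_toReal] at this
  -- (i) the `L^∞` part: `√t ‖e^{tΔ}u₀‖_∞ ≤ √(d C₀ K) ρ`, `d = dim E`
  have hsup : eKochTataruSupPart (fun t => Literature.Analysis.UnboundedOperators.heatExtension u₀ t) ≤
      ENNReal.ofReal (Real.sqrt (Module.finrank ℝ E * C₀ * K)) * ρ := by
    refine iSup₂_le fun t ht => ?_
    -- pointwise bound
    have hpt : ∀ y, ‖Literature.Analysis.UnboundedOperators.heatExtension u₀ t y‖ ≤ Real.sqrt (Module.finrank ℝ E * C₀ * K) * ρ.toReal / Real.sqrt t := by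
      intro y
      have hsq_le : ‖Literature.Analysis.UnboundedOperators.heatExtension u₀ t y‖ ^ 2 ≤ Module.finrank ℝ E * C₀ * K * ρ.toReal ^ 2 / t := by
        rw [norm_heatExtension_sq_eq_sum htemp b ht y]
        calc ∑ i, FunctionSpaces.BMOInv.heatExtension (fun z => ⟪u₀ z, b i⟫) t y ^ 2
            ≤ ∑ _i : Fin (Module.finrank ℝ E), C₀ * (K * ρ.toReal ^ 2) / t := by
              refine Finset.sum_le_sum fun i _ => ?_
              obtain ⟨Ki, hKi⟩ := htemp.integrable_growth_inner (b i)
              calc FunctionSpaces.BMOInv.heatExtension (fun z => ⟪u₀ z, b i⟫) t y ^ 2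
                  ≤ C₀ * (FunctionSpaces.BMOInv.eCarlesonNorm (fun z => ⟪u₀ z, b i⟫)).toReal / t :=
                    hsq hKi (hγfin i) ht y
                _ ≤ C₀ * (K * ρ.toReal ^ 2) / t := by gcongr; exact hγreal i
          _ = Module.finrank ℝ E * C₀ * K * ρ.toReal ^ 2 / t := by
              rw [Finset.sum_const, Finset.card_univ, Fintype.card_fin, nsmul_eq_mul]; ring
      have hrhs : Module.finrank ℝ E * C₀ * K * ρ.toReal ^ 2 / t = (Real.sqrt (Module.finrank ℝ E * C₀ * K) * ρ.toReal / Real.sqrt t) ^ 2 := by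
        rw [div_pow, mul_pow, Real.sq_sqrt (by positivity), Real.sq_sqrt ht.le]
      rw [hrhs] at hsq_le
      exact (pow_le_pow_iff_left₀ (norm_nonneg _) (by positivity) two_ne_zero).1 hsq_le
    have hess : eLpNorm (Literature.Analysis.UnboundedOperators.heatExtension u₀ t) ∞ volume ≤
        ENNReal.ofReal (Real.sqrt (Module.finrank ℝ E * C₀ * K) * ρ.toReal / Real.sqrt t) := by
      rw [eLpNorm_exponent_top]
      exact eLpNormEssSup_le_of_ae_bound (Eventually.of_forall hpt)
    calc ENNReal.ofReal (Real.sqrt t) * eLpNorm (Literature.Analysis.UnboundedOperators.heatExtension u₀ t) ∞ volume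
        ≤ ENNReal.ofReal (Real.sqrt t) *
            ENNReal.ofReal (Real.sqrt (Module.finrank ℝ E * C₀ * K) * ρ.toReal / Real.sqrt t) := by gcongr
      _ = ENNReal.ofReal (Real.sqrt (Module.finrank ℝ E * C₀ * K) * ρ.toReal) := by
          rw [← ENNReal.ofReal_mul (Real.sqrt_nonneg _), mul_div_cancel₀ _ (Real.sqrt_pos.2 ht).ne']
      _ = ENNReal.ofReal (Real.sqrt (Module.finrank ℝ E * C₀ * K)) * ρ := by
          rw [ENNReal.ofReal_mul (Real.sqrt_nonneg _), ENNReal.ofReal_toReal hρfin.ne]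
  -- (ii) the Carleson part: `≤ √(d K) ρ`
  have hcarl : eKochTataruCarlesonPart (fun t => Literature.Analysis.UnboundedOperators.heatExtension u₀ t) ≤
      ENNReal.ofReal (Real.sqrt (Module.finrank ℝ E * K)) * ρ := by
    refine iSup_le fun x => iSup₂_le fun R hR => ?_
    -- pointwise: `‖e^{tΔ}u₀‖ₑ² ≤ Σᵢ ‖e^{tΔ}wᵢ‖ₑ²`
    have hptw : ∀ ⦃t : ℝ⦄, 0 < t → ∀ y : E, ‖Literature.Analysis.UnboundedOperators.heatExtension u₀ t y‖ₑ ^ 2 ≤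
        1 * ∑ i, (fun p : ℝ × E => ‖FunctionSpaces.BMOInv.heatExtension (fun z => ⟪u₀ z, b i⟫) p.1 p.2‖ₑ ^ 2)
          (t, y) := by
      intro t ht y
      rw [one_mul]
      calc ‖Literature.Analysis.UnboundedOperators.heatExtension u₀ t y‖ₑ ^ 2 = ENNReal.ofReal (‖Literature.Analysis.UnboundedOperators.heatExtension u₀ t y‖ ^ 2) := by
            rw [ENNReal.ofReal_pow (norm_nonneg _), ofReal_norm]
        _ = ENNReal.ofReal (∑ i, FunctionSpaces.BMOInv.heatExtension (fun z => ⟪u₀ z, b i⟫) t y ^ 2) := by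
            rw [norm_heatExtension_sq_eq_sum htemp b ht y]
        _ = ∑ i, ENNReal.ofReal (FunctionSpaces.BMOInv.heatExtension (fun z => ⟪u₀ z, b i⟫) t y ^ 2) :=
            ENNReal.ofReal_sum_of_nonneg fun i _ => sq_nonneg _
        _ = ∑ i, ‖FunctionSpaces.BMOInv.heatExtension (fun z => ⟪u₀ z, b i⟫) t y‖ₑ ^ 2 := by
            refine Finset.sum_congr rfl fun i _ => ?_
            rw [Real.enorm_eq_ofReal_abs, ← ENNReal.ofReal_pow (abs_nonneg _), sq_abs]
        _ ≤ _ := le_rfl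
    have hmeas : ∀ i, Measurable fun p : ℝ × E =>
        ‖FunctionSpaces.BMOInv.heatExtension (fun z => ⟪u₀ z, b i⟫) p.1 p.2‖ₑ ^ 2 := fun i =>
      (FunctionSpaces.BMOInv.measurable_heatExtension
        (htemp.aestronglyMeasurable.inner_const :
          AEStronglyMeasurable (fun z => ⟪u₀ z, b i⟫) volume)).enorm.pow_const 2
    have hbox := FunctionSpaces.lintegral_box_le_of_pointwise hmeas hptw x R
    rw [one_mul] at hbox
    -- each component box is `≤ R^d γᵢ ≤ R^d K ρ²`
    have hRd : ENNReal.ofReal (R ^ Module.finrank ℝ E) ≠ 0 := by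
      simpa [ENNReal.ofReal_eq_zero, not_le] using pow_pos hR (Module.finrank ℝ E)
    have hcompbox : ∀ i, (ENNReal.ofReal (R ^ Module.finrank ℝ E))⁻¹ *
        ∫⁻ t in Ioo 0 (R ^ 2), ∫⁻ y in ball x R,
          ‖FunctionSpaces.BMOInv.heatExtension (fun z => ⟪u₀ z, b i⟫) t y‖ₑ ^ 2 ≤ K * ρ ^ 2 := fun i =>
      calc _ ≤ FunctionSpaces.BMOInv.eCarlesonNorm (fun z => ⟪u₀ z, b i⟫) :=
            le_iSup_of_le x (le_iSup₂_of_le R hR le_rfl)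
        _ ≤ K * ρ ^ 2 := hγ i
    calc ((ENNReal.ofReal (R ^ Module.finrank ℝ E))⁻¹ *
          ∫⁻ t in Ioo 0 (R ^ 2), ∫⁻ y in ball x R, ‖Literature.Analysis.UnboundedOperators.heatExtension u₀ t y‖ₑ ^ 2) ^ (1 / 2 : ℝ)
        ≤ ((ENNReal.ofReal (R ^ Module.finrank ℝ E))⁻¹ * ∑ i, ∫⁻ t in Ioo 0 (R ^ 2), ∫⁻ y in ball x R,
            ‖FunctionSpaces.BMOInv.heatExtension (fun z => ⟪u₀ z, b i⟫) t y‖ₑ ^ 2) ^ (1 / 2 : ℝ) := by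
          gcongr
      _ = (∑ i, (ENNReal.ofReal (R ^ Module.finrank ℝ E))⁻¹ * ∫⁻ t in Ioo 0 (R ^ 2), ∫⁻ y in ball x R,
            ‖FunctionSpaces.BMOInv.heatExtension (fun z => ⟪u₀ z, b i⟫) t y‖ₑ ^ 2) ^ (1 / 2 : ℝ) := by
          rw [Finset.mul_sum]
      _ ≤ (∑ _i : Fin (Module.finrank ℝ E), (K : ℝ≥0∞) * ρ ^ 2) ^ (1 / 2 : ℝ) :=
          ENNReal.rpow_le_rpow (Finset.sum_le_sum fun i _ => hcompbox i) (by norm_num)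
      _ = ((Module.finrank ℝ E : ℝ≥0∞) * K * ρ ^ 2) ^ (1 / 2 : ℝ) := by
          rw [Finset.sum_const, Finset.card_univ, Fintype.card_fin, nsmul_eq_mul]; ring_nf
      _ = ENNReal.ofReal (Real.sqrt (Module.finrank ℝ E * K)) * ρ := by
          have h1 : ((ρ ^ 2 : ℝ≥0∞)) ^ (1 / 2 : ℝ) = ρ := by
            rw [← ENNReal.rpow_natCast, ← ENNReal.rpow_mul]; norm_num
          have h2 : ((Module.finrank ℝ E : ℝ≥0∞) * K) ^ (1 / 2 : ℝ) = ENNReal.ofReal (Real.sqrt (Module.finrank ℝ E * K)) := by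
            have : ((Module.finrank ℝ E : ℝ≥0∞) * K) = ENNReal.ofReal ((Module.finrank ℝ E : ℝ) * K) := by
              rw [ENNReal.ofReal_mul (by positivity), ENNReal.ofReal_natCast,
                ENNReal.ofReal_coe_nnreal]
            rw [this, ENNReal.ofReal_rpow_of_nonneg (by positivity) (by norm_num),
              Real.sqrt_eq_rpow]
          rw [ENNReal.mul_rpow_of_nonneg _ _ (by norm_num : (0 : ℝ) ≤ 1 / 2), h1, h2]
  -- assemble
  calc eKochTataruNorm (fun t => Literature.Analysis.UnboundedOperators.heatExtension u₀ t)
      = eKochTataruSupPart (fun t => Literature.Analysis.UnboundedOperators.heatExtension u₀ t) +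
          eKochTataruCarlesonPart (fun t => Literature.Analysis.UnboundedOperators.heatExtension u₀ t) := rfl
    _ ≤ ENNReal.ofReal (Real.sqrt (Module.finrank ℝ E * C₀ * K)) * ρ + ENNReal.ofReal (Real.sqrt (Module.finrank ℝ E * K)) * ρ :=
        add_le_add hsup hcarl
    _ ≤ ENNReal.ofReal A * ρ := by
        rw [← add_mul, ← ENNReal.ofReal_add (Real.sqrt_nonneg _) (Real.sqrt_nonneg _)]
        gcongr
        rw [hA]
        linarith

end Linear

end Literature.Analysis.FluidPDE

namespace Literature.Analysis.FluidPDE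

section Summit

/-- **Koch–Tataru's Theorem 2 from Lemmas 3.1–3.2 and the two passages between the integral
equation and the class** (Koch–Tataru 2001, Theorem 2 with §3): with (L2) discharged in this
file and the fixed point proved in `KochTataruFixedPoint.lean`, the named fact `NS.koch_tataru`
(**ns.S15**) follows from (L1) `kochTataruBilinear_estimate`, (T3)
`isKochTataruSolution_of_integral` and (T4) `integral_of_isKochTataruSolution` on `ℝ³`.
[cite: KochTataruAdvMath2001, Theorem 2 and §3 (Lemmas 3.1–3.2)] -/
theorem koch_tataru_of_L1_T3_T4 (hL1 : kochTataruBilinear_estimate (EuclideanSpace ℝ (Fin 3)))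
    (hMILD : isKochTataruSolution_of_integral (EuclideanSpace ℝ (Fin 3))) (hCONV : integral_of_isKochTataruSolution (EuclideanSpace ℝ (Fin 3))) :
    koch_tataru :=
  koch_tataru_of_lemmas hL1 (eKochTataruNorm_heatExtension_le_holds (EuclideanSpace ℝ (Fin 3))) hMILD hCONV

end Summit

end Literature.Analysis.FluidPDE
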